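import Mathlib.Probability.Distributions.SetBernoulli
import Mathlib.MeasureTheory.Measure.Real
import Literature.Probability.Percolation.Crossings
import Literature.Probability.Percolation.SitePercolationMeasure

/-!
# The cell law at `u = 0` (support item `SmirnovCellAnchor` of route ModulusResponse)

Helper file for `Summit.CriticalPhenomena.CardyFormulaZ2.Theses.ModulusResponse.SmirnovCellAnchor`
(stmt-CriticalPhenomena-6471). The route pins the cell family `μ_u` by its defining equation: the
push-forward of `setBer(univ, 1/2) ⊗ setBer(univ, u)` under the cell map which opens, at every
vertex `m` of `ℤ²`, the left edge `{m - e₀, m}` iff `m ∈ X` and the down edge `{m - e₁, m}` iff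
`m ∈ X xor m ∈ D`. At `u = 0` the defect set `D` is a.s. empty, so `μ_0` is the law of the
configuration `Φ X = {left and down edges of the sites of X}` for `X ∼ P^{site}_{1/2}`
(`measure_zero_eq_map`, `measureReal_zero_apply`). All objects are pinned by hypotheses (no
definitions). Relabelling invariance of the site law under lattice symmetries is recorded in the
form used later (`sitePercolation_real_image_relabel`).
-/

noncomputable section

namespace Summit.CriticalPhenomena.CardyFormulaZ2.Theorems.SmirnovCellAnchor

open MeasureTheory ProbabilityTheory Set
open Literature.Probability.Percolation Literature.Probability.LatticeModels

/-- Measurability of the two-layer cell map `(X, D) ↦ {left edges of X} ∪ {down edges of X Δ D}`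
(each coordinate `e ∈ ·` is a countable union over the vertices of `ℤ²` of measurable
conditions). [folklore] -/
theorem measurable_cellMap :
    Measurable (fun p : Set (Site 2) × Set (Site 2) ↦
      ({e | ∃ m, (m ∈ p.1 ∧ e = s(m - Pi.single 0 1, m)) ∨
        ((m ∈ p.1 ↔ m ∉ p.2) ∧ e = s(m - Pi.single 1 1, m))} : BondConfig (Site 2))) := by
  refine measurable_set_iff.2 fun e => ?_
  simp only [mem_setOf_eq]
  refine Measurable.exists fun m => Measurable.or (Measurable.and ?_ measurable_const)
    (Measurable.and (Measurable.iff ?_ (Measurable.not ?_)) measurable_const)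
  · exact (measurable_set_mem m).comp measurable_fst
  · exact (measurable_set_mem m).comp measurable_fst
  · exact (measurable_set_mem m).comp measurable_snd

/-- Measurability of the one-layer cell map `X ↦ {left and down edges of the sites of X}`.
[folklore] -/
theorem measurable_cellConfig :
    Measurable (fun X : Set (Site 2) ↦
      ({e | ∃ m ∈ X, e = s(m - Pi.single 0 1, m) ∨ e = s(m - Pi.single 1 1, m)} :
        BondConfig (Site 2))) := by
  refine measurable_set_iff.2 fun e => ?_
  simp only [mem_setOf_eq]
  exact Measurable.exists fun m => Measurable.and (measurable_set_mem m) measurable_const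

/-- **The cell law at `u = 0` is the law of the one-layer configuration**: with `D ∼ setBer(univ, 0) = δ_∅`
the defect layer disappears and `μ_0 = (Φ)_* P^{site}_{1/2}`,
`Φ X = {left and down edges of the sites of X}`. [folklore] -/
theorem measure_zero_eq_map (μ : ℝ → Measure (BondConfig (Site 2)))
    (hμ : ∀ u, μ u = Measure.map (fun p : Set (Site 2) × Set (Site 2) ↦
      {e | ∃ m, (m ∈ p.1 ∧ e = s(m - Pi.single 0 1, m)) ∨
        ((m ∈ p.1 ↔ m ∉ p.2) ∧ e = s(m - Pi.single 1 1, m))})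
      ((setBernoulli Set.univ half).prod (setBernoulli Set.univ (Set.projIcc 0 1 zero_le_one u)))) :
    μ 0 = Measure.map (fun X : Set (Site 2) ↦
      ({e | ∃ m ∈ X, e = s(m - Pi.single 0 1, m) ∨ e = s(m - Pi.single 1 1, m)} : BondConfig (Site 2)))
      (sitePercolation (Site 2) half) := by
  rw [hμ 0]
  have h0 : Set.projIcc (0 : ℝ) 1 zero_le_one 0 = 0 := by rw [Set.projIcc_left]; rfl
  have hmeas : Measurable (fun x : Set (Site 2) ↦ (x, (∅ : Set (Site 2)))) :=
    measurable_id.prodMk measurable_const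
  rw [h0, setBernoulli_zero, Measure.prod_dirac, Measure.map_map measurable_cellMap hmeas]
  unfold sitePercolation
  congr 1
  funext X
  ext e
  simp only [Function.comp_apply, mem_setOf_eq, mem_empty_iff_false, not_false_eq_true, iff_true]
  constructor
  · rintro ⟨m, ⟨hm, h⟩ | ⟨hm, h⟩⟩
    · exact ⟨m, hm, Or.inl h⟩
    · exact ⟨m, hm, Or.inr h⟩
  · rintro ⟨m, hm, h | h⟩
    · exact ⟨m, Or.inl ⟨hm, h⟩⟩
    · exact ⟨m, Or.inr ⟨hm, h⟩⟩

/-- **Probabilities under `μ_0`** of measurable events are site-percolation probabilities of the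
pulled-back events. [folklore] -/
theorem measureReal_zero_apply (μ : ℝ → Measure (BondConfig (Site 2)))
    (hμ : ∀ u, μ u = Measure.map (fun p : Set (Site 2) × Set (Site 2) ↦
      {e | ∃ m, (m ∈ p.1 ∧ e = s(m - Pi.single 0 1, m)) ∨
        ((m ∈ p.1 ↔ m ∉ p.2) ∧ e = s(m - Pi.single 1 1, m))})
      ((setBernoulli Set.univ half).prod (setBernoulli Set.univ (Set.projIcc 0 1 zero_le_one u))))
    {E : Set (BondConfig (Site 2))} (hE : MeasurableSet E) :
    (μ 0).real E = (sitePercolation (Site 2) half).real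
      {X | ({e | ∃ m ∈ X, e = s(m - Pi.single 0 1, m) ∨ e = s(m - Pi.single 1 1, m)} :
        BondConfig (Site 2)) ∈ E} := by
  rw [measure_zero_eq_map μ hμ, map_measureReal_apply measurable_cellConfig hE]
  rfl

/-- **Relabelling invariance, image form**: for a bijection `e` of the sites and any family `S` of
configurations, `P_p {X | e '' X ∈ S} = P_p S`. [folklore] -/
theorem sitePercolation_real_image_relabel {V : Type*} (e : V ≃ V) (p : unitInterval)
    (S : Set (SiteConfig V)) :
    (sitePercolation V p).real {X | e '' X ∈ S} = (sitePercolation V p).real S :=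
  sitePercolation_real_preimage_relabel e p S

end Summit.CriticalPhenomena.CardyFormulaZ2.Theorems.SmirnovCellAnchor

end
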